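import Literature.Algebra.EuclideanLattices.SmoothingGaussianMomentFormulas
import HarnessLib

/-!
# MR07 Lemma 4.2: the first two directional moments of `D_{Λ,s,c}` for `s ≥ 2η_ε(Λ)` — proved

Topic `Algebra/EuclideanLattices` (family `pqc`), sequel of `SmoothingGaussianMomentFormulas.lean`;
serves the decomposition of Micciancio–Regev 2007, Thm. 5.23
(`Literature.Computability.Cryptography.MicciancioRegev2007_gapCVP'_to_SIS'`), whose NO-case analysis
uses **Lemma 4.2** in eqs. (19)–(20) (authors' version p. 31): for an `n`-dimensional lattice `Λ`,
`c ∈ ℝⁿ`, a unit vector `u`, `0 < ε < 1` and `s ≥ 2η_ε(Λ)`,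
`|Exp_{x∼D_{Λ,s,c}}[⟨x - c, u⟩]| ≤ εs/(1-ε)` and `|Exp[⟨x - c, u⟩²] - s²/(2π)| ≤ εs²/(1-ε)`.
Everything is PROVED; theorems only; the moments are written as quotients of lattice series
(`Exp_{D_{L,s,c}}[g] = (∑_{x ∈ L} g(x) ρ_s(x - c)) / ρ_{s,c}(L)`), for an arbitrary direction `u`
(factors `‖u‖`, `‖u‖²`).

## Proof (as printed, pp. 13–14, through the moment Poisson formulas of the prequel)

`∑_x ⟪x - c, u⟫ρ_s(x - c) = -s²K ∑_y ρ_{1/s}(y)⟪u, y⟫ sin(2π⟪c, y⟫)` and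
`∑_x ⟪x - c, u⟫²ρ_s(x - c) - (s²‖u‖²/2π)ρ_{s,c}(L) = -s⁴K ∑_y ρ_{1/s}(y)⟪u, y⟫² cos(2π⟪c, y⟫)`,
`K = vol(L)⁻¹sⁿ`; the dual sums are at most `‖u‖ ∑_{y ≠ 0} ‖y‖ρ_{1/s}(y) ≤ ‖u‖ s⁻¹ ρ_{2/s}(L* ∖ {0}) ≤ ‖u‖ε/s`
resp. `‖u‖² s⁻² ρ_{2/s}(L* ∖ {0}) ≤ ‖u‖²ε/s²` (MR07: "`|y₁| ≤ ‖y‖ ≤ …`, `… = ρ₂(Λ* ∖ {0}) ≤ ε` where the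
last inequality uses `η_ε(Λ) ≤ 1/2`"; here `a e^{-πa²} ≤ e^{-πa²/4}`, `a² e^{-πa²} ≤ e^{-πa²/4}` with
`a = s‖y‖`), and `ρ_{s,c}(L) ≥ (1 - ε)K` (`le_tsum_gaussianFunction_sub_of_smoothingParameter_le`).

## Results (`0 < ε < 1`, `0 < s`, `2η_ε(L) ≤ s`, `c u ∈ V`)

* `norm_mul_gaussianFunction_inv_le`, `norm_sq_mul_gaussianFunction_inv_le`,
  `tsum_norm_mul_gaussianFunction_inv_le`, `tsum_norm_sq_mul_gaussianFunction_inv_le` — the dual tail sums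
  `∑_y ‖y‖ρ_{1/s}(y) ≤ ε/s`, `∑_y ‖y‖²ρ_{1/s}(y) ≤ ε/s²`.
* `abs_tsum_inner_mul_gaussianFunction_sub_div_le` — **MR07 Lemma 4.2, first moment**:
  `|∑_x ⟪x - c, u⟫ρ_s(x - c)| / ρ_{s,c}(L) ≤ ε s ‖u‖/(1 - ε)`.
* `abs_tsum_inner_sq_mul_gaussianFunction_sub_div_sub_le` — **MR07 Lemma 4.2, second moment**:
  `|(∑_x ⟪x - c, u⟫²ρ_s(x - c)) / ρ_{s,c}(L) - s²‖u‖²/(2π)| ≤ ε s² ‖u‖²/(1 - ε)`.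
* `tsum_norm_sq_mul_gaussianFunction_sub_div_le` — **MR07 Lemma 4.3 (second part)**:
  `(∑_x ‖x - c‖²ρ_s(x - c)) / ρ_{s,c}(L) ≤ (1/(2π) + ε/(1-ε)) s² n`.

## References

* D. Micciancio, O. Regev, *Worst-case to average-case reductions based on Gaussian measures*,
  SIAM J. Comput. 37 (2007) 267–302, Lemma 4.2 and Lemma 4.3 (authors' version pp. 13–14).
-/

noncomputable section

open MeasureTheory Module Metric Filter Set
open scoped Real ENNReal InnerProductSpace Topology

namespace Literature.Algebra.EuclideanLattices

section Elementary

variable {V : Type*} [NormedAddCommGroup V]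

/-- `a ≤ e^{(3π/4)a²}` for `a ≥ 0` (if `a ≤ 1` then `a ≤ 1 ≤ e^{…}`; else `a ≤ a² ≤ (3π/4)a² ≤ e^{…} - 1`).
[folklore] -/
theorem le_exp_three_pi_div_four_mul_sq {a : ℝ} (ha : 0 ≤ a) : a ≤ Real.exp (3 * π / 4 * a ^ 2) := by
  have hπ : (3 : ℝ) < π := Real.pi_gt_three
  have h1 : 3 * π / 4 * a ^ 2 + 1 ≤ Real.exp (3 * π / 4 * a ^ 2) := Real.add_one_le_exp _
  rcases le_or_gt a 1 with h | h
  · nlinarith [sq_nonneg a]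
  · nlinarith

/-- **`‖y‖ρ_{1/s}(y) ≤ s⁻¹ ρ_{2/s}(y)` off the origin** (MR07, proof of Lemma 4.2: "`|y₁| ρ(y) ≤ … ≤ ρ₂`"):
for `s > 0` and `y ≠ 0`, `‖y‖ e^{-πs²‖y‖²} ≤ s⁻¹ e^{-πs²‖y‖²/4}`; at `y = 0` the left side vanishes.
[cite: MicciancioRegev2007, Lemma 4.2 (proof, p. 14)] -/
theorem norm_mul_gaussianFunction_inv_le {s : ℝ} (hs : 0 < s) (y : V) :
    ‖y‖ * gaussianFunction s⁻¹ y ≤ s⁻¹ * gaussianFunction (s / 2)⁻¹ y := by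
  have e1 : gaussianFunction s⁻¹ y = Real.exp (-π * ‖y‖ ^ 2 * s ^ 2) := by
    rw [← one_div, gaussianFunction_one_div]
  have e2 : gaussianFunction (s / 2)⁻¹ y = Real.exp (-π * ‖y‖ ^ 2 * (s / 2) ^ 2) := by
    rw [← one_div, gaussianFunction_one_div]
  have ha := le_exp_three_pi_div_four_mul_sq (mul_nonneg hs.le (norm_nonneg y))
  rw [e1, e2, le_inv_mul_iff₀ hs]
  calc s * (‖y‖ * Real.exp (-π * ‖y‖ ^ 2 * s ^ 2))
      = (s * ‖y‖) * Real.exp (-π * ‖y‖ ^ 2 * s ^ 2) := by ring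
    _ ≤ Real.exp (3 * π / 4 * (s * ‖y‖) ^ 2) * Real.exp (-π * ‖y‖ ^ 2 * s ^ 2) :=
        mul_le_mul_of_nonneg_right ha (Real.exp_pos _).le
    _ = Real.exp (-π * ‖y‖ ^ 2 * (s / 2) ^ 2) := by rw [← Real.exp_add]; congr 1; ring

/-- **`‖y‖²ρ_{1/s}(y) ≤ s⁻² ρ_{2/s}(y)`** (MR07, proof of Lemma 4.2: "`y₁² ρ(y) ≤ … ≤ ρ₂`"): for `s > 0`,
`‖y‖² e^{-πs²‖y‖²} ≤ s⁻² e^{-πs²‖y‖²/4}` (`a² ≤ e^{(3π/4)a²}`). [cite: MicciancioRegev2007, Lemma 4.2 (proof, p. 14)] -/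
theorem norm_sq_mul_gaussianFunction_inv_le {s : ℝ} (hs : 0 < s) (y : V) :
    ‖y‖ ^ 2 * gaussianFunction s⁻¹ y ≤ (s ^ 2)⁻¹ * gaussianFunction (s / 2)⁻¹ y := by
  have e1 : gaussianFunction s⁻¹ y = Real.exp (-π * ‖y‖ ^ 2 * s ^ 2) := by
    rw [← one_div, gaussianFunction_one_div]
  have e2 : gaussianFunction (s / 2)⁻¹ y = Real.exp (-π * ‖y‖ ^ 2 * (s / 2) ^ 2) := by
    rw [← one_div, gaussianFunction_one_div]
  rw [e1, e2]
  have hπ : (3 : ℝ) < π := Real.pi_gt_three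
  have ha : (s * ‖y‖) ^ 2 ≤ Real.exp (3 * π / 4 * (s * ‖y‖) ^ 2) := by
    have h1 := Real.add_one_le_exp (3 * π / 4 * (s * ‖y‖) ^ 2)
    nlinarith [sq_nonneg (s * ‖y‖)]
  rw [le_inv_mul_iff₀ (pow_pos hs 2)]
  calc s ^ 2 * (‖y‖ ^ 2 * Real.exp (-π * ‖y‖ ^ 2 * s ^ 2))
      = (s * ‖y‖) ^ 2 * Real.exp (-π * ‖y‖ ^ 2 * s ^ 2) := by ring
    _ ≤ Real.exp (3 * π / 4 * (s * ‖y‖) ^ 2) * Real.exp (-π * ‖y‖ ^ 2 * s ^ 2) :=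
        mul_le_mul_of_nonneg_right ha (Real.exp_pos _).le
    _ = Real.exp (-π * ‖y‖ ^ 2 * (s / 2) ^ 2) := by rw [← Real.exp_add]; congr 1; ring

end Elementary

section Lattice

variable {V : Type*} [NormedAddCommGroup V] [InnerProductSpace ℝ V] [FiniteDimensional ℝ V]
  [MeasurableSpace V] [BorelSpace V]
variable (L : Submodule ℤ V) [DiscreteTopology L] [IsZLattice ℝ L]

open scoped Classical in
omit [MeasurableSpace V] [BorelSpace V] in
/-- The punctured dual mass at parameter `2/s` is at most `ε` when `2η_ε(L) ≤ s`, as a real series: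
`∑_{y ∈ L*} [y ≠ 0] ρ_{2/s}(y) ≤ ε` (MR07: "`ρ₂(Λ* ∖ {0}) ≤ ε` … uses `η_ε(Λ) ≤ 1/2`", after scaling).
[cite: MicciancioRegev2007, Lemma 4.2 (proof, p. 14)] -/
theorem tsum_ite_gaussianFunction_half_inv_le {ε s : ℝ} (hε : 0 < ε) (hs : 0 < s)
    (hηs : 2 * smoothingParameter L ε ≤ s) :
    ∑' y : dualLattice L, (if y = 0 then 0 else gaussianFunction (s / 2)⁻¹ (y : V)) ≤ ε := by
  have hσ : (s / 2)⁻¹ ≠ 0 := inv_ne_zero (by positivity)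
  have h1 : gaussianMass (1 / (s / 2)) 0 ((dualLattice L : Set V) \ {0}) ≤ ENNReal.ofReal ε :=
    gaussianMass_dual_le_of_smoothingParameter_le L hε (by linarith)
  rw [one_div, gaussianMass_dual_sdiff_zero_eq_ofReal_tsum_ite L hσ] at h1
  exact (ENNReal.ofReal_le_ofReal_iff hε.le).1 h1

omit [MeasurableSpace V] [BorelSpace V] in
/-- **First dual tail sum**: `∑_{y ∈ L*} ‖y‖ ρ_{1/s}(y) ≤ ε/s` for `0 < ε`, `0 < s`, `2η_ε(L) ≤ s`.
[cite: MicciancioRegev2007, Lemma 4.2 (proof, p. 14)] -/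
theorem tsum_norm_mul_gaussianFunction_inv_le {ε s : ℝ} (hε : 0 < ε) (hs : 0 < s)
    (hηs : 2 * smoothingParameter L ε ≤ s) :
    ∑' y : dualLattice L, ‖(y : V)‖ * gaussianFunction s⁻¹ (y : V) ≤ ε / s := by
  classical
  have hS1 : Summable fun y : dualLattice L ↦ ‖(y : V)‖ * gaussianFunction s⁻¹ (y : V) :=
    summable_of_le_mul_norm_pow_mul_gaussianFunction L hs zero_le_one (k := 1) (by norm_num)
      (fun y ↦ mul_nonneg (norm_nonneg _) (gaussianFunction_pos _ _).le) fun y ↦ by rw [pow_one, one_mul]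
  have hnn : ∀ y : dualLattice L, 0 ≤ (if y = 0 then 0 else gaussianFunction (s / 2)⁻¹ (y : V)) := fun y ↦ by
    split_ifs
    · exact le_rfl
    · exact (gaussianFunction_pos _ _).le
  have hρS : Summable fun y : dualLattice L ↦ gaussianFunction (s / 2)⁻¹ (y : V) :=
    (summable_gaussianFunction_sub (dualLattice L) (s := (s / 2)⁻¹) (inv_ne_zero (by positivity)) (0 : V)).congr
      fun y ↦ by rw [sub_zero]
  have hS2 : Summable fun y : dualLattice L ↦ s⁻¹ * (if y = 0 then 0 else gaussianFunction (s / 2)⁻¹ (y : V)) := by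
    refine (Summable.of_nonneg_of_le hnn (fun y ↦ ?_) hρS).mul_left _
    split_ifs
    · exact (gaussianFunction_pos _ _).le
    · exact le_rfl
  have hle : ∀ y : dualLattice L, ‖(y : V)‖ * gaussianFunction s⁻¹ (y : V) ≤
      s⁻¹ * (if y = 0 then 0 else gaussianFunction (s / 2)⁻¹ (y : V)) := fun y ↦ by
    split_ifs with hy
    · simp [hy]
    · exact norm_mul_gaussianFunction_inv_le hs (y : V)
  calc ∑' y : dualLattice L, ‖(y : V)‖ * gaussianFunction s⁻¹ (y : V)
      ≤ ∑' y : dualLattice L, s⁻¹ * (if y = 0 then 0 else gaussianFunction (s / 2)⁻¹ (y : V)) :=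
        hS1.tsum_le_tsum hle hS2
    _ = s⁻¹ * ∑' y : dualLattice L, (if y = 0 then 0 else gaussianFunction (s / 2)⁻¹ (y : V)) := tsum_mul_left
    _ ≤ s⁻¹ * ε := mul_le_mul_of_nonneg_left (tsum_ite_gaussianFunction_half_inv_le L hε hs hηs) (inv_nonneg.2 hs.le)
    _ = ε / s := by rw [inv_mul_eq_div]

omit [MeasurableSpace V] [BorelSpace V] in
/-- **Second dual tail sum**: `∑_{y ∈ L*} ‖y‖² ρ_{1/s}(y) ≤ ε/s²` for `0 < ε`, `0 < s`, `2η_ε(L) ≤ s`.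
[cite: MicciancioRegev2007, Lemma 4.2 (proof, p. 14)] -/
theorem tsum_norm_sq_mul_gaussianFunction_inv_le {ε s : ℝ} (hε : 0 < ε) (hs : 0 < s)
    (hηs : 2 * smoothingParameter L ε ≤ s) :
    ∑' y : dualLattice L, ‖(y : V)‖ ^ 2 * gaussianFunction s⁻¹ (y : V) ≤ ε / s ^ 2 := by
  classical
  have hS1 : Summable fun y : dualLattice L ↦ ‖(y : V)‖ ^ 2 * gaussianFunction s⁻¹ (y : V) :=
    summable_of_le_mul_norm_pow_mul_gaussianFunction L hs zero_le_one (k := 2) le_rfl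
      (fun y ↦ mul_nonneg (sq_nonneg _) (gaussianFunction_pos _ _).le) fun y ↦ by rw [one_mul]
  have hnn : ∀ y : dualLattice L, 0 ≤ (if y = 0 then 0 else gaussianFunction (s / 2)⁻¹ (y : V)) := fun y ↦ by
    split_ifs
    · exact le_rfl
    · exact (gaussianFunction_pos _ _).le
  have hρS : Summable fun y : dualLattice L ↦ gaussianFunction (s / 2)⁻¹ (y : V) :=
    (summable_gaussianFunction_sub (dualLattice L) (s := (s / 2)⁻¹) (inv_ne_zero (by positivity)) (0 : V)).congr
      fun y ↦ by rw [sub_zero]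
  have hS2 : Summable fun y : dualLattice L ↦ (s ^ 2)⁻¹ * (if y = 0 then 0 else gaussianFunction (s / 2)⁻¹ (y : V)) := by
    refine (Summable.of_nonneg_of_le hnn (fun y ↦ ?_) hρS).mul_left _
    split_ifs
    · exact (gaussianFunction_pos _ _).le
    · exact le_rfl
  have hle : ∀ y : dualLattice L, ‖(y : V)‖ ^ 2 * gaussianFunction s⁻¹ (y : V) ≤
      (s ^ 2)⁻¹ * (if y = 0 then 0 else gaussianFunction (s / 2)⁻¹ (y : V)) := fun y ↦ by
    split_ifs with hy
    · simp [hy]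
    · exact norm_sq_mul_gaussianFunction_inv_le hs (y : V)
  calc ∑' y : dualLattice L, ‖(y : V)‖ ^ 2 * gaussianFunction s⁻¹ (y : V)
      ≤ ∑' y : dualLattice L, (s ^ 2)⁻¹ * (if y = 0 then 0 else gaussianFunction (s / 2)⁻¹ (y : V)) :=
        hS1.tsum_le_tsum hle hS2
    _ = (s ^ 2)⁻¹ * ∑' y : dualLattice L, (if y = 0 then 0 else gaussianFunction (s / 2)⁻¹ (y : V)) := tsum_mul_left
    _ ≤ (s ^ 2)⁻¹ * ε :=
        mul_le_mul_of_nonneg_left (tsum_ite_gaussianFunction_half_inv_le L hε hs hηs) (inv_nonneg.2 (sq_nonneg _))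
    _ = ε / s ^ 2 := by rw [inv_mul_eq_div]

/-- **Micciancio–Regev 2007, Lemma 4.2 (first moment)**: for a full-rank lattice `L`, centre `c`,
direction `u`, `0 < ε < 1`, `0 < s` with `2η_ε(L) ≤ s`,
`|∑_{x ∈ L} ⟪x - c, u⟫ ρ_s(x - c)| / ρ_{s,c}(L) ≤ ε s ‖u‖ / (1 - ε)`, i.e.
`|Exp_{x∼D_{L,s,c}}[⟨x - c, u⟩]| ≤ εs/(1-ε)` for a unit vector `u`. [cite: MicciancioRegev2007, Lemma 4.2] -/
theorem abs_tsum_inner_mul_gaussianFunction_sub_div_le {ε s : ℝ} (hε : 0 < ε) (hε1 : ε < 1) (hs : 0 < s)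
    (hηs : 2 * smoothingParameter L ε ≤ s) (c u : V) :
    |∑' x : L, ⟪(x : V) - c, u⟫_ℝ * gaussianFunction s ((x : V) - c)| / ∑' x : L, gaussianFunction s ((x : V) - c) ≤
      ε * s * ‖u‖ / (1 - ε) := by
  set K : ℝ := (ZLattice.covolume L)⁻¹ * s ^ finrank ℝ V with hK
  have hcov : 0 < ZLattice.covolume L := ZLattice.covolume_pos L volume
  have hK0 : 0 < K := by positivity
  have hZ : 0 < ∑' x : L, gaussianFunction s ((x : V) - c) := tsum_gaussianFunction_sub_pos L hs.ne' c
  have hη : smoothingParameter L ε ≤ s := by linarith [smoothingParameter_nonneg L ε]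
  -- numerator
  have hD : |∑' y : dualLattice L, gaussianFunction s⁻¹ (y : V) * ⟪u, (y : V)⟫_ℝ * Real.sin (2 * π * ⟪c, (y : V)⟫_ℝ)| ≤
      ‖u‖ * (ε / s) := by
    have hS := (summable_of_le_mul_norm_pow_mul_gaussianFunction L hs (norm_nonneg u) (k := 1) (by norm_num)
      (fun y ↦ mul_nonneg (mul_nonneg (norm_nonneg u) (norm_nonneg _)) (gaussianFunction_pos _ _).le)
      (fun y ↦ by rw [pow_one, mul_assoc]) :
        Summable fun y : dualLattice L ↦ ‖u‖ * ‖(y : V)‖ * gaussianFunction s⁻¹ (y : V))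
    rw [← Real.norm_eq_abs]
    refine (tsum_of_norm_bounded hS.hasSum fun y ↦ ?_).trans ?_
    · rw [Real.norm_eq_abs, abs_mul, abs_mul, abs_of_pos (gaussianFunction_pos _ _)]
      calc gaussianFunction s⁻¹ (y : V) * |⟪u, (y : V)⟫_ℝ| * |Real.sin (2 * π * ⟪c, (y : V)⟫_ℝ)|
          ≤ gaussianFunction s⁻¹ (y : V) * (‖u‖ * ‖(y : V)‖) * 1 :=
            mul_le_mul (mul_le_mul_of_nonneg_left (abs_real_inner_le_norm _ _) (gaussianFunction_pos _ _).le)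
              (Real.abs_sin_le_one _) (abs_nonneg _) (mul_nonneg (gaussianFunction_pos _ _).le (by positivity))
        _ = ‖u‖ * ‖(y : V)‖ * gaussianFunction s⁻¹ (y : V) := by ring
    · have h := tsum_norm_mul_gaussianFunction_inv_le L hε hs hηs
      calc ∑' y : dualLattice L, ‖u‖ * ‖(y : V)‖ * gaussianFunction s⁻¹ (y : V)
          = ‖u‖ * ∑' y : dualLattice L, ‖(y : V)‖ * gaussianFunction s⁻¹ (y : V) := by
            rw [← tsum_mul_left]; exact tsum_congr fun y ↦ by ring
        _ ≤ ‖u‖ * (ε / s) := mul_le_mul_of_nonneg_left h (norm_nonneg _)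
  have hnum : |∑' x : L, ⟪(x : V) - c, u⟫_ℝ * gaussianFunction s ((x : V) - c)| ≤ s ^ 2 * K * (‖u‖ * (ε / s)) := by
    rw [tsum_inner_mul_gaussianFunction_sub_eq L hs c u, abs_neg, abs_mul, abs_of_pos (by positivity : 0 < s ^ 2 * K)]
    exact mul_le_mul_of_nonneg_left hD (by positivity)
  -- denominator
  have hden : (1 - ε) * K ≤ ∑' x : L, gaussianFunction s ((x : V) - c) := by
    have h := le_tsum_gaussianFunction_sub_of_smoothingParameter_le L hε hs hη c
    rwa [div_eq_inv_mul] at h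
  have h1ε : 0 < 1 - ε := by linarith
  rw [div_le_div_iff₀ hZ h1ε]
  calc |∑' x : L, ⟪(x : V) - c, u⟫_ℝ * gaussianFunction s ((x : V) - c)| * (1 - ε)
      ≤ s ^ 2 * K * (‖u‖ * (ε / s)) * (1 - ε) := mul_le_mul_of_nonneg_right hnum h1ε.le
    _ = ε * s * ‖u‖ * ((1 - ε) * K) := by field_simp
    _ ≤ ε * s * ‖u‖ * ∑' x : L, gaussianFunction s ((x : V) - c) := mul_le_mul_of_nonneg_left hden (by positivity)

/-- **Micciancio–Regev 2007, Lemma 4.2 (second moment)**: for a full-rank lattice `L`, centre `c`,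
direction `u`, `0 < ε < 1`, `0 < s` with `2η_ε(L) ≤ s`,
`|(∑_{x ∈ L} ⟪x - c, u⟫² ρ_s(x - c)) / ρ_{s,c}(L) - s²‖u‖²/(2π)| ≤ ε s² ‖u‖² / (1 - ε)`, i.e.
`|Exp_{x∼D_{L,s,c}}[⟨x - c, u⟩²] - s²/(2π)| ≤ εs²/(1-ε)` for a unit vector `u`. [cite: MicciancioRegev2007, Lemma 4.2] -/
theorem abs_tsum_inner_sq_mul_gaussianFunction_sub_div_sub_le {ε s : ℝ} (hε : 0 < ε) (hε1 : ε < 1) (hs : 0 < s)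
    (hηs : 2 * smoothingParameter L ε ≤ s) (c u : V) :
    |(∑' x : L, ⟪(x : V) - c, u⟫_ℝ ^ 2 * gaussianFunction s ((x : V) - c)) / ∑' x : L, gaussianFunction s ((x : V) - c) -
        s ^ 2 * ‖u‖ ^ 2 / (2 * π)| ≤
      ε * s ^ 2 * ‖u‖ ^ 2 / (1 - ε) := by
  set K : ℝ := (ZLattice.covolume L)⁻¹ * s ^ finrank ℝ V with hK
  have hcov : 0 < ZLattice.covolume L := ZLattice.covolume_pos L volume
  have hK0 : 0 < K := by positivity
  have hZ : 0 < ∑' x : L, gaussianFunction s ((x : V) - c) := tsum_gaussianFunction_sub_pos L hs.ne' c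
  have hη : smoothingParameter L ε ≤ s := by linarith [smoothingParameter_nonneg L ε]
  set M₂ : ℝ := ∑' x : L, ⟪(x : V) - c, u⟫_ℝ ^ 2 * gaussianFunction s ((x : V) - c) with hM₂
  set P : ℝ := ∑' x : L, gaussianFunction s ((x : V) - c) with hP
  -- the dual sum
  have hD : |∑' y : dualLattice L, gaussianFunction s⁻¹ (y : V) * ⟪u, (y : V)⟫_ℝ ^ 2 * Real.cos (2 * π * ⟪c, (y : V)⟫_ℝ)| ≤
      ‖u‖ ^ 2 * (ε / s ^ 2) := by
    have hS := (summable_of_le_mul_norm_pow_mul_gaussianFunction L hs (sq_nonneg ‖u‖) (k := 2) le_rfl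
      (fun y ↦ mul_nonneg (mul_nonneg (sq_nonneg ‖u‖) (sq_nonneg _)) (gaussianFunction_pos _ _).le)
      (fun y ↦ by rw [mul_assoc]) :
        Summable fun y : dualLattice L ↦ ‖u‖ ^ 2 * ‖(y : V)‖ ^ 2 * gaussianFunction s⁻¹ (y : V))
    rw [← Real.norm_eq_abs]
    refine (tsum_of_norm_bounded hS.hasSum fun y ↦ ?_).trans ?_
    · rw [Real.norm_eq_abs, abs_mul, abs_mul, abs_of_pos (gaussianFunction_pos _ _)]
      have hin : |⟪u, (y : V)⟫_ℝ ^ 2| ≤ ‖u‖ ^ 2 * ‖(y : V)‖ ^ 2 := by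
        rw [abs_pow, ← mul_pow]
        exact pow_le_pow_left₀ (abs_nonneg _) (abs_real_inner_le_norm _ _) 2
      calc gaussianFunction s⁻¹ (y : V) * |⟪u, (y : V)⟫_ℝ ^ 2| * |Real.cos (2 * π * ⟪c, (y : V)⟫_ℝ)|
          ≤ gaussianFunction s⁻¹ (y : V) * (‖u‖ ^ 2 * ‖(y : V)‖ ^ 2) * 1 :=
            mul_le_mul (mul_le_mul_of_nonneg_left hin (gaussianFunction_pos _ _).le)
              (Real.abs_cos_le_one _) (abs_nonneg _) (mul_nonneg (gaussianFunction_pos _ _).le (by positivity))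
        _ = ‖u‖ ^ 2 * ‖(y : V)‖ ^ 2 * gaussianFunction s⁻¹ (y : V) := by ring
    · have h := tsum_norm_sq_mul_gaussianFunction_inv_le L hε hs hηs
      calc ∑' y : dualLattice L, ‖u‖ ^ 2 * ‖(y : V)‖ ^ 2 * gaussianFunction s⁻¹ (y : V)
          = ‖u‖ ^ 2 * ∑' y : dualLattice L, ‖(y : V)‖ ^ 2 * gaussianFunction s⁻¹ (y : V) := by
            rw [← tsum_mul_left]; exact tsum_congr fun y ↦ by ring
        _ ≤ ‖u‖ ^ 2 * (ε / s ^ 2) := mul_le_mul_of_nonneg_left h (sq_nonneg _)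
  have hnum : |M₂ - s ^ 2 * ‖u‖ ^ 2 / (2 * π) * P| ≤ s ^ 4 * K * (‖u‖ ^ 2 * (ε / s ^ 2)) := by
    rw [hM₂, hP, tsum_inner_sq_mul_gaussianFunction_sub_eq L hs c u, abs_neg, abs_mul,
      abs_of_pos (by positivity : 0 < s ^ 4 * K)]
    exact mul_le_mul_of_nonneg_left hD (by positivity)
  have hden : (1 - ε) * K ≤ P := by
    have h := le_tsum_gaussianFunction_sub_of_smoothingParameter_le L hε hs hη c
    rwa [div_eq_inv_mul] at h
  have h1ε : 0 < 1 - ε := by linarith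
  have hPpos : 0 < P := hZ
  -- `|M₂/P - a| = |M₂ - aP|/P`
  have hrew : M₂ / P - s ^ 2 * ‖u‖ ^ 2 / (2 * π) = (M₂ - s ^ 2 * ‖u‖ ^ 2 / (2 * π) * P) / P := by
    field_simp
  rw [hrew, abs_div, abs_of_pos hPpos, div_le_div_iff₀ hPpos h1ε]
  calc |M₂ - s ^ 2 * ‖u‖ ^ 2 / (2 * π) * P| * (1 - ε)
      ≤ s ^ 4 * K * (‖u‖ ^ 2 * (ε / s ^ 2)) * (1 - ε) := mul_le_mul_of_nonneg_right hnum h1ε.le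
    _ = ε * s ^ 2 * ‖u‖ ^ 2 * ((1 - ε) * K) := by field_simp
    _ ≤ ε * s ^ 2 * ‖u‖ ^ 2 * P := mul_le_mul_of_nonneg_left hden (by positivity)

/-- **Micciancio–Regev 2007, Lemma 4.3 (second part, series form)**: for a full-rank lattice `L` in
dimension `n`, centre `c`, `0 < ε < 1`, `0 < s` with `2η_ε(L) ≤ s`,
`Exp_{x∼D_{L,s,c}}[‖x - c‖²] = (∑_{x ∈ L} ‖x - c‖² ρ_s(x - c)) / ρ_{s,c}(L) ≤ (1/(2π) + ε/(1-ε)) s² n`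
(sum Lemma 4.2 over an orthonormal basis `u₁, …, uₙ`, as printed, p. 14). [cite: MicciancioRegev2007, Lemma 4.3] -/
theorem tsum_norm_sq_mul_gaussianFunction_sub_div_le {ε s : ℝ} (hε : 0 < ε) (hε1 : ε < 1) (hs : 0 < s)
    (hηs : 2 * smoothingParameter L ε ≤ s) (c : V) :
    (∑' x : L, ‖(x : V) - c‖ ^ 2 * gaussianFunction s ((x : V) - c)) / ∑' x : L, gaussianFunction s ((x : V) - c) ≤
      (1 / (2 * π) + ε / (1 - ε)) * s ^ 2 * finrank ℝ V := by
  set b : OrthonormalBasis (Fin (finrank ℝ V)) ℝ V := stdOrthonormalBasis ℝ V with hb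
  have hexp : ∀ x : L, ‖(x : V) - c‖ ^ 2 * gaussianFunction s ((x : V) - c) =
      ∑ i, ⟪(x : V) - c, b i⟫_ℝ ^ 2 * gaussianFunction s ((x : V) - c) := fun x ↦ by
    rw [← Finset.sum_mul, b.sum_sq_inner_left]
  have hsw : ∑' x : L, ‖(x : V) - c‖ ^ 2 * gaussianFunction s ((x : V) - c) =
      ∑ i, ∑' x : L, ⟪(x : V) - c, b i⟫_ℝ ^ 2 * gaussianFunction s ((x : V) - c) := by
    rw [tsum_congr hexp]
    exact Summable.tsum_finsetSum fun i _ ↦ summable_inner_sq_mul_gaussianFunction_sub L hs c (b i)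
  rw [hsw, Finset.sum_div]
  have hi : ∀ i, (∑' x : L, ⟪(x : V) - c, b i⟫_ℝ ^ 2 * gaussianFunction s ((x : V) - c)) /
      ∑' x : L, gaussianFunction s ((x : V) - c) ≤ (1 / (2 * π) + ε / (1 - ε)) * s ^ 2 := fun i ↦ by
    have h := abs_tsum_inner_sq_mul_gaussianFunction_sub_div_sub_le L hε hε1 hs hηs c (b i)
    rw [b.orthonormal.1 i, one_pow, mul_one, mul_one] at h
    have h2 := (abs_le.1 h).2
    have : s ^ 2 / (2 * π) + ε * s ^ 2 / (1 - ε) = (1 / (2 * π) + ε / (1 - ε)) * s ^ 2 := by ring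
    linarith
  calc ∑ i, (∑' x : L, ⟪(x : V) - c, b i⟫_ℝ ^ 2 * gaussianFunction s ((x : V) - c)) /
        ∑' x : L, gaussianFunction s ((x : V) - c)
      ≤ ∑ _i : Fin (finrank ℝ V), (1 / (2 * π) + ε / (1 - ε)) * s ^ 2 := Finset.sum_le_sum fun i _ ↦ hi i
    _ = (1 / (2 * π) + ε / (1 - ε)) * s ^ 2 * finrank ℝ V := by
        rw [Finset.sum_const, Finset.card_univ, Fintype.card_fin, nsmul_eq_mul]
        ring

end Lattice

end Literature.Algebra.EuclideanLattices

end
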